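import Summits.SmoothPoincare4.SmoothPoincare4.Theses.QuaternionicSimilarity
import Literature.Geometry.Riemannian.GreatSphereFibrationsHahl
import Literature.Geometry.Riemannian.GreatSphereFibrationBaseSphere
import Literature.Topology.FourManifolds.HomotopySpheresGroup
import Literature.Topology.FourManifolds.SmoothOrientationSphereProofs

/-!
# Redirect-strategist audit (r1) — crux `QuaternionicSimilarity.GreatFibrationBaseStandard` (stmt-SmoothPoincare4-6272)

Seat `planner-cstrat-stmt-SmoothPoincare4-6272-r1-0`, 2026-08-17. Kernel-checked companion of
`STRATEGY-CENSUS.md` (same crux directory). Route `route-SmoothPoincare4-QuaternionicSimilarity`,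
`closes (hS : Straighten) (hB : GreatFibrationBaseStandard) : SmoothPoincare4`.

What is checked here (all sorry-free):

§1 THE CRUX AS TYPED is a theorem of the tree — it is verbatim the Literature fact
   `Hahl1987_greatSphereFibration_base_sphere`, proved (vacuously: the fibre clause elaborates to
   `Subtype.val '' (p ⁻¹' {p x}) = ↑V`, unsatisfiable) by `…_vacuous`. Hence `S → C` holds trivially and the
   deterministic BC7 probe's `CLEAN` verdict is a false negative of its P1/P2 batteries.
§2 THE SIBLING AS TYPED is false (`not_straighten_asTyped`), so `Straighten → S` holds ex falso: as typed the
   cone of `closes` is {refutable, trivially true}.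
§3 THE REPAIRED STATEMENTS (fibre clause typed in `Set ↥S⁷`, class misstated): `GreatFibrationBaseStandardR`
   (= Hähl 1987 §4.8, a published theorem; in-tree split Prop 4.7 ∧ Cerf proved: `baseStandardR_of_prop47_of_cerf`),
   `StraightenR`, `HopfGreatFibrationR`; the repaired glue `closesR`; and the COSTUME THEOREM for the sibling:
   `straightenR_of_spc4 : HopfGreatFibrationR → SmoothPoincare4 → StraightenR`, hence
   `straightenR_iff_spc4 : HopfGreatFibrationR → GreatFibrationBaseStandardR → (StraightenR ↔ SmoothPoincare4)` —
   modulo two theorems in print (the quaternionic Hopf fibration; Hähl 1987) the route's only other load-bearing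
   crux is the summit restated.
-/

set_option linter.dupNamespace false
set_option linter.unusedVariables false

noncomputable section

open scoped Manifold ContDiff Topology
open Summit.SmoothPoincare4.SmoothPoincare4.Theses.QuaternionicSimilarity

namespace Summit.SmoothPoincare4.SmoothPoincare4.Cruxes.GreatFibrationBaseStandard.StrategistAudit

/-! ## §1 The crux as typed -/

/-- The crux is VERBATIM the (mis-typed, vacuous) Literature fact of `GreatSphereFibrationsHahl.lean`. -/
theorem crux_iff_hahlFact :
    GreatFibrationBaseStandard ↔
      Literature.Geometry.Riemannian.Hahl1987_greatSphereFibration_base_sphere := Iff.rfl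

/-- **The crux AS TYPED is a theorem of the tree** (P1 `crux.in-tree`): its fibre hypothesis is unsatisfiable. -/
theorem crux_asTyped : GreatFibrationBaseStandard :=
  Literature.Geometry.Riemannian.Hahl1987_greatSphereFibration_base_sphere_vacuous

/-- Hence the converse probe `S → C` holds in substance (trivially), although the syntactic battery fails. -/
theorem spc4_imp_crux_asTyped : SmoothPoincare4 → GreatFibrationBaseStandard := fun _ => crux_asTyped

/-- Indeed ANYTHING implies the crux as typed (every "decomposition" of it is costume). -/
theorem anything_imp_crux_asTyped (X : Prop) : X → GreatFibrationBaseStandard := fun _ => crux_asTyped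

/-- A point of `S⁷`. -/
theorem single_mem_sphere :
    (EuclideanSpace.single (0 : Fin 8) (1 : ℝ)) ∈ Metric.sphere (0 : EuclideanSpace ℝ (Fin 8)) 1 := by
  simp

/-- The typed fibre clause is unsatisfiable: no subset of `S⁷` has image a linear subspace of `ℝ⁸` (P2 by hand). -/
theorem image_val_ne_submodule (A : Set (Metric.sphere (0 : EuclideanSpace ℝ (Fin 8)) 1))
    (V : Submodule ℝ (EuclideanSpace ℝ (Fin 8))) :
    Subtype.val '' A ≠ (V : Set (EuclideanSpace ℝ (Fin 8))) := by
  intro hV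
  have h0 : (0 : EuclideanSpace ℝ (Fin 8)) ∈ (V : Set (EuclideanSpace ℝ (Fin 8))) := V.zero_mem
  rw [← hV] at h0
  obtain ⟨y, -, hy⟩ := h0
  have hy1 : ‖(y : EuclideanSpace ℝ (Fin 8))‖ = 1 := by
    have := y.2
    rwa [Metric.mem_sphere, dist_zero_right] at this
  rw [hy, norm_zero] at hy1
  exact zero_ne_one hy1

/-- The fibre hypothesis of the crux, read back literally: it is an equation in `Set ℝ⁸` (P2 `crux.hyps-vacuous`
by hand — for every `M`, `p`, `x` the hypothesis `hfib x` is refutable). -/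
theorem fibreHyp_asTyped_false {M : Type} (p : Metric.sphere (0 : EuclideanSpace ℝ (Fin 8)) 1 → M)
    (x : Metric.sphere (0 : EuclideanSpace ℝ (Fin 8)) 1) :
    ¬ ∃ V : Submodule ℝ (EuclideanSpace ℝ (Fin 8)), Module.finrank ℝ V = 4 ∧
        p ⁻¹' {p x} = {y | (y : EuclideanSpace ℝ (Fin 8)) ∈ V} := by
  rintro ⟨V, -, hV⟩
  exact image_val_ne_submodule _ V hV

/-! ## §2 The sibling crux `Straighten` (stmt-6271) as typed -/

/-- `Straighten` as typed is FALSE (reproduces `Cruxes/Straighten/AsTypedRefutation.lean`, registrar 6271). -/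
theorem not_straighten_asTyped : ¬ Straighten := by
  intro h
  obtain ⟨o⟩ := (Literature.Topology.FourManifolds.isOrientable_sphere_holds 4 : Nonempty _)
  obtain ⟨p, -, -, -, hfib⟩ := h (Literature.Topology.FourManifolds.HomotopySphere.sphere o)
  exact fibreHyp_asTyped_false p ⟨_, single_mem_sphere⟩ (hfib ⟨_, single_mem_sphere⟩)

/-- So, as typed, the sibling "gives S alone" — ex falso; the cone of `closes` is {false, trivially true}. -/
theorem straighten_asTyped_imp_spc4 : Straighten → SmoothPoincare4 := fun h => (not_straighten_asTyped h).elim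

/-- `HopfGreatFibration` (support stmt-6274) as typed is false too (the model case is NOT inhabited as typed). -/
theorem not_hopfGreatFibration_asTyped : ¬ HopfGreatFibration := by
  rintro ⟨p, -, -, -, hfib⟩
  exact fibreHyp_asTyped_false p ⟨_, single_mem_sphere⟩ (hfib ⟨_, single_mem_sphere⟩)

/-! ## §3 The repaired statements (class misstated: fibre clause typed in `Set ↥S⁷`) -/

/-- **BASE, repaired** (`GreatFibrationBaseStandardR`): Hähl 1987 §4.8 — the base of a smooth great-3-sphere
fibration of `S⁷` (smooth surjective submersion with fibres `{y : S⁷ | ↑y ∈ V}`, `dim V = 4`) is `≅ S⁴`.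
Identical to the crux except for the typed binder. [Hahl1987, Thm 1.3 / Prop 4.7 / §4.8] -/
def GreatFibrationBaseStandardR : Prop :=
  ∀ (M : Type) [TopologicalSpace M] [T2Space M] [SecondCountableTopology M]
    [ChartedSpace (EuclideanSpace ℝ (Fin 4)) M] [IsManifold (𝓡 4) ∞ M]
    (p : Metric.sphere (0 : EuclideanSpace ℝ (Fin 8)) 1 → M),
    ContMDiff (𝓡 7) (𝓡 4) ∞ p → Function.Surjective p →
    (∀ x, Function.Surjective (mfderiv (𝓡 7) (𝓡 4) p x)) →
    (∀ x, ∃ V : Submodule ℝ (EuclideanSpace ℝ (Fin 8)), Module.finrank ℝ V = 4 ∧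
      p ⁻¹' {p x} = {y : Metric.sphere (0 : EuclideanSpace ℝ (Fin 8)) 1 | (y : EuclideanSpace ℝ (Fin 8)) ∈ V}) →
    Nonempty (M ≃ₘ⟮𝓡 4, 𝓡 4⟯ Metric.sphere (0 : EuclideanSpace ℝ (Fin 5)) 1)

/-- **STRAIGHTEN, repaired** (`StraightenR`; = registrar 6271's `BirthDraft.StraightenR`). -/
def StraightenR : Prop :=
  ∀ S : Literature.Topology.FourManifolds.HomotopySphere 4,
    ∃ p : Metric.sphere (0 : EuclideanSpace ℝ (Fin 8)) 1 → S.carrier,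
      ContMDiff (𝓡 7) (𝓡 4) ∞ p ∧ Function.Surjective p ∧
      (∀ x, Function.Surjective (mfderiv (𝓡 7) (𝓡 4) p x)) ∧
      ∀ x, ∃ V : Submodule ℝ (EuclideanSpace ℝ (Fin 8)), Module.finrank ℝ V = 4 ∧
        p ⁻¹' {p x} = {y : Metric.sphere (0 : EuclideanSpace ℝ (Fin 8)) 1 | (y : EuclideanSpace ℝ (Fin 8)) ∈ V}

/-- **HOPF, repaired** (`HopfGreatFibrationR`): the quaternionic Hopf map `S⁷ → S⁴` is a smooth surjective
submersion with great-3-sphere fibres (folklore; provable now). -/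
def HopfGreatFibrationR : Prop :=
  ∃ p : Metric.sphere (0 : EuclideanSpace ℝ (Fin 8)) 1 → Metric.sphere (0 : EuclideanSpace ℝ (Fin 5)) 1,
    ContMDiff (𝓡 7) (𝓡 4) ∞ p ∧ Function.Surjective p ∧
    (∀ x, Function.Surjective (mfderiv (𝓡 7) (𝓡 4) p x)) ∧
    ∀ x, ∃ V : Submodule ℝ (EuclideanSpace ℝ (Fin 8)), Module.finrank ℝ V = 4 ∧
      p ⁻¹' {p x} = {y : Metric.sphere (0 : EuclideanSpace ℝ (Fin 8)) 1 | (y : EuclideanSpace ℝ (Fin 8)) ∈ V}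

/-- The repaired glue: same six lines as the route's `closes`. -/
theorem closesR (hS : StraightenR) (hB : GreatFibrationBaseStandardR) : SmoothPoincare4 := by
  unfold SmoothPoincare4 Literature.SPC4.SmoothPoincareConjectureFour
    ContinuousMap.HomotopyEquiv.NonemptyDiffeomorphSphere
  intro M _ _ _ _ _ e
  haveI : CompactSpace M :=
    Literature.Topology.FourManifolds.compactSpace_of_homotopyEquiv_sphere_four_holds M e
  obtain ⟨o⟩ :=
    Literature.Topology.FourManifolds.isOrientable_of_homotopyEquiv_sphere_four_holds M e
  obtain ⟨p, hp, hsurj, hsub, hfib⟩ := hS ⟨M, o, ⟨e⟩⟩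
  exact hB M p hp hsurj hsub hfib

/-- **The honest two-piece split of the REPAIRED crux is already proved in the tree** (Hähl §4.8 =
Prop 4.7 + Cerf `Γ₄ = 0`): `Literature.Geometry.Riemannian.Hahl1987_greatSphereFibration_base_sphere_of_isTwistedSphere_of_cerf`. -/
theorem baseStandardR_of_prop47_of_cerf
    (h47 : ∀ (M : Type) [TopologicalSpace M] [T2Space M] [SecondCountableTopology M]
      [ChartedSpace (EuclideanSpace ℝ (Fin 4)) M] [IsManifold (𝓡 4) ∞ M]
      (p : Metric.sphere (0 : EuclideanSpace ℝ (Fin 8)) 1 → M),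
      ContMDiff (𝓡 7) (𝓡 4) ∞ p → Function.Surjective p →
      (∀ x, Function.Surjective (mfderiv (𝓡 7) (𝓡 4) p x)) →
      (∀ x, ∃ V : Submodule ℝ (EuclideanSpace ℝ (Fin 8)), Module.finrank ℝ V = 4 ∧
        p ⁻¹' {p x} = {y : Metric.sphere (0 : EuclideanSpace ℝ (Fin 8)) 1 |
          (y : EuclideanSpace ℝ (Fin 8)) ∈ V}) →
      ∃ φ : (Metric.sphere (0 : EuclideanSpace ℝ (Fin 4)) 1) ≃ₘ⟮𝓡 3, 𝓡 3⟯
          (Metric.sphere (0 : EuclideanSpace ℝ (Fin 4)) 1),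
        Literature.Topology.FourManifolds.IsTwistedSphere 3 φ M)
    (hC : Literature.Topology.FourManifolds.cerf_twistedSphere_four) :
    GreatFibrationBaseStandardR :=
  fun M _ _ _ _ _ p hp hsurj hsubm hfib =>
    Literature.Geometry.Riemannian.Hahl1987_greatSphereFibration_base_sphere_of_isTwistedSphere_of_cerf
      h47 hC M p hp hsurj hsubm hfib

/-- **COSTUME THEOREM for the sibling.** Given the (repaired, provable-now) Hopf fibration, SPC4 implies the
repaired `Straighten`: transport the Hopf map along the diffeomorphism `Σ ≅ S⁴` that SPC4 provides. -/
theorem straightenR_of_spc4 (hH : HopfGreatFibrationR) (h4 : SmoothPoincare4) : StraightenR := by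
  intro S
  obtain ⟨p₀, hp₀, hsurj₀, hsub₀, hfib₀⟩ := hH
  have h4' : ContinuousMap.HomotopyEquiv.NonemptyDiffeomorphSphere S.carrier 4 := h4 S.carrier
  obtain ⟨φ⟩ := h4' S.chartedSpace S.isManifold S.nonempty_homotopyEquiv.some
  have hne : (∞ : WithTop ℕ∞) ≠ 0 := by simp
  have hinj : Function.Injective φ.symm := fun a b h => by simpa using congrArg φ h
  refine ⟨φ.symm ∘ p₀, φ.symm.contMDiff.comp hp₀, ?_, ?_, ?_⟩
  · exact fun m => by
      obtain ⟨y, hy⟩ := hsurj₀ (φ m)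
      exact ⟨y, by simp [Function.comp_apply, hy]⟩
  · intro x
    rw [mfderiv_comp x ((φ.symm.mdifferentiable hne) (p₀ x)) ((hp₀.mdifferentiable hne) x)]
    have hφ : Function.Surjective (mfderiv (𝓡 4) (𝓡 4) φ.symm (p₀ x)) := by
      rw [← Diffeomorph.mfderivToContinuousLinearEquiv_coe φ.symm hne]
      exact (φ.symm.mfderivToContinuousLinearEquiv hne (p₀ x)).surjective
    exact hφ.comp (hsub₀ x)
  · intro x
    obtain ⟨V, hV4, hV⟩ := hfib₀ x
    refine ⟨V, hV4, ?_⟩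
    rw [← hV]
    ext y
    simp [hinj.eq_iff]

/-- **Hence, modulo two theorems in print (Hopf; Hähl 1987), the sibling crux is the summit restated.** -/
theorem straightenR_iff_spc4 (hH : HopfGreatFibrationR) (hB : GreatFibrationBaseStandardR) :
    StraightenR ↔ SmoothPoincare4 :=
  ⟨fun hS => closesR hS hB, straightenR_of_spc4 hH⟩

end Summit.SmoothPoincare4.SmoothPoincare4.Cruxes.GreatFibrationBaseStandard.StrategistAudit

end
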